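import Mathlib
import Literature.MathematicalPhysics.QuantumFieldTheory.Balaban1983to89.T4EtaRateSiteOfRatePair

/-!
# `Balaban1983to89.T4EtaRateSiteTorus` — PERIODISATION TO THE UNIT TORUS of the typed NE2 site layer: the single-scale
`U ≡ 1` instance of [B9]'s site carrier 𝔅 whose sites are the points of the unit torus `Π_μ ℤ/N_μ`, its dictionary, and its
first inhabitant BY NAME — the (1.66)-layer torus entry kernels, at the rate exponents `γ = 1` AND King's full `γ = 2` —
UNIFORMLY IN THE VOLUME

v1 p189119 e08ba5a4cfc1; v1.1 = v1 with §6 APPENDED (the (1.66) inhabitant at King's exponent `γ = 2` from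
`T4Rate166StripDirect.ksum_rate2_king`, + the general-exponent `ne2ZeroSite_torus_of_bound_rpow`; every v1 declaration
byte-kept) and the header sentences on the rate exponent corrected accordingly (v1 said the tree's torus rate theorem is first
order only — `ksum_rate2_king` is second order); v1.1 p189276 2c8211a7cd8e.  v1.2 (unit `b2b-balaban-pv25-g16`) = the RETYPE
`## v1.2` below: [B9]'s cube-size parameter `M` threaded through the torus carrier family as an index, plus the §4 READOUT
equivalences and a separating family — the referee's repair R1 of XREAD C-pv05g13-12, VACUITY-OF-TYPE V1 (same repair as
`T4EtaRateSiteOfRatePair` v1.2).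

Cell `pub-balaban`, units `b2b-balaban-pv25-g15` / `-g16` (the η-rate lineage: `T4EtaRate` p178744, `T4RateAlgebra` p178920,
`T4EtaRateUnitWitness` p185409, `T4EtaRateDefect` p187761, `T4EtaRateDefectSite` p187690, `T4EtaRateSiteOfRatePair`
p188614; T4-DAG node U1a = the NE2 background layer, record `t4/T4-EST-U1a.md`).  Self-row T4-U1a.S-NE2-SITE-TORUS° = item
(K4b) of the gen-14 successor menu: `T4EtaRateSiteOfRatePair` wired the unit-lattice rate pairs of `T4RateAlgebra` into the
typed shapes `T4EtaRate.EtaRateIneqSite` / `NE2PlusSite` on FINITE WINDOWS OF THE INFINITE UNIT LATTICE `ℤ^d` and declared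
(HONEST SCOPE (i) there): *"periodisation to the torus `T₁` is NOT done here — the torus kernels are the `ksum` of
`B5Kernel166Decay`"*.  This module does the periodisation: the carrier is the finite unit torus itself, and the torus rate
theorems already in the tree for the (1.66) layer — `T4GaugeActionRateStrip.ksum_rate_king` (first order in `η`, a quarter
of the strip width) and `T4Rate166StripDirect.ksum_rate2_king` (SECOND order in `η` = King's exponent, the full strip width),
both by seat t4-ne2-p2 and both UNIFORM IN THE PERIOD VECTOR — are read into the typed site layer BY NAME.  (The (1.63)
`H_k`-multiplier torus kernels, whose rate theorem `T4Hk163StripRate.torusKernel_G163_rate_king` has the same format, are read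
in by the companion leaf `T4EtaRateSiteTorus163` through §3's producer; nothing of them is used here.)

## The object (§1)

With NO large-field regions (the `U ≡ 1` sub-theory) [B9]'s carrier `𝔅 = ⋃_{j ≤ k} Λ_j` (p. 397) is the single top layer
`Λ_k` = the UNIT lattice of the run with `k` scales (`L^kη = 1`, `η = L^{−k}`); in finite volume this unit lattice is the
unit TORUS `T₁ = Π_μ ℤ/N_μ` — the type `B5Prop11Plancherel.Tor N` on which the torus kernels `B5Kernel166Decay.ksum N n` of
the (1.66) entry symbols live (`N_μ` = number of unit-lattice sites in direction `μ`; [Balaban1984PropagatorsI] (1.29) p. 23).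
`torusSiteGeo d L M k N` is this carrier as a `B9.Geometry`: sites `Tor N`, `scale ≡ k`, `η = (L^k)⁻¹`, [B9]'s cube-size
parameter `M` of (3.35) as an ARGUMENT (v1.2; inert in the `U ≡ 1` model, carried only so that the guard `M₅ ≤ M` of the packaged
shapes means "for every `M ≥ M₅`"), inert one-point argument / cut-off sorts, and `dist y y′ = |y − y′|_{T,∞}` = the torus sup-distance
`B4TorusKernel.MultiPeriod.torusSupNorm N` of a representative ([Balaban1984PropagatorsI] p. 17 l. 30 with p. 36 l. 20–23,
dictionary, as in `B4TorusKernel`) — the metric in which every torus-kernel decay / rate theorem of the tree is stated.  The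
two runs `k` (coarse, `η`) and `k + 1` (fine, `η′ = η/L`) have THE SAME unit torus (same `N`: the physical volume and the unit
scale are fixed, only the fine structure below the unit scale changes), so the η-pairing is the identity on `Tor N` (King's
convention, [King1986] p. 664) and the family index is `(k, N, M)`, ALL `M ≥ 1` (`TorusIndex`).  The η-DIFFERENCE SITE KERNEL of a fine and a
coarse translation-invariant torus function is `torusStepKernel Xf Xc L M k : (U, y, y′) ↦ Xf(y − y′) − Xc(y − y′)` (two-level
form; for a scale-indexed family `X` take `Xf = X (k+1)`, `Xc = X k`, which is what `torusStepKernels` does over the index).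

## What is here (0 sorry; every declaration [folklore] = elementary bookkeeping, or a shape-location [cite])

* §1 the carrier `torusSiteGeo`, `torusSiteGeo_len` (`L^jη = 1`), `rateFactor_torusSiteGeo` (King's factor IS `(L^{−γ})^k`),
  `torusStepKernel`, `torusPairing` (`n = 1`), `TorusIndex`, `torusInstance`, `TorusFamily`, `torusStepKernels`.
* §2 representatives: `exists_eq_translate_of_isPeriod_sub`, `torusSupNorm_eq_of_isPeriod_sub`, `torusSupNorm_rep_toT`
  (`|rep(x̄)|_{T,∞} = |x|_{T,∞}`), `torusKernel_eq_of_isPeriod_sub`, `torusKernel_rep_toT` — the torus sup-distance and the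
  `MultiPeriod.torusKernel` do not depend on the representative (`B6LowerBound2153Torus.isPeriod_rep_toT_sub` +
  `torusSupNorm_translate` / `torusKernel_translate` BY NAME).
* §3 THE DICTIONARY: `etaRateIneqSite_torus_iff` (on the torus carrier the (3.48) weights are `1` and the max-rate-factor is
  `θ^k`, `θ = L^{−γ}`), `etaRateIneqSite_torus_iff'` (translation invariance: one torus point suffices),
  `etaRateIneqSite_torus_iff_lattice` (the same at lattice representatives `x ∈ ℤ^{d+1}` with `torusSupNorm N x` — THE FORMAT
  OF THE TREE'S TORUS RATE THEOREMS), and the producers `etaRateIneqSite_torus_of_bound_rpow` (amplitude `A·(L^k)^{−γ}`) /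
  `etaRateIneqSite_torus_of_bound` (amplitude `A·(L^k)⁻¹`, `γ = 1`).
* §4 packaging over the `(k, N)`-family: `ne2PlusSite_torus_of_bound(_rpow)`, `ne2ZeroSite_torus_of_bound` — a torus step bound
  with constants `(A, δ, γ)` INDEPENDENT OF `(k, N)` inhabits `T4EtaRate.NE2PlusSite d′ p c35 torusInstance …` and
  `T4EtaRateSiteOfRatePair.NE2ZeroSite`, constants `(M₅, δ, a₀, C, γ) = (1, δ, 1, max A 1, γ)` — the uniformity in the
  volume is now INSIDE the existential, as the row's quantifier template demands; `ne2ZeroSite_torus_of_bound_rpow` (general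
  exponent; v1.1, moved here); and (v1.2) THE READOUT — the packaged types are NOT vacuous and NOT more than NE2⁰-at-`U ≡ 1`:
  `exists_bound_of_ne2ZeroSite_torus` (a proof of `NE2ZeroSite` on the torus family RETURNS a `(k, N)`-UNIFORM torus step
  bound `|X_N(k+1)(x̄) − X_N k(x̄)| ≤ C·(L^k)^{−γ}·e^{−δ|x|_{T,∞}}` with `C, δ, γ > 0`; index `M := max M₅ 1`), the EQUIVALENCES
  `ne2ZeroSite_torus_iff_bound` / `ne2PlusSite_torus_iff_bound` (both packaged types ⟺ `∃ A δ γ > 0`, that bound), and the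
  SEPARATING FAMILY `not_ne2ZeroSite_torus_pow_two` / `not_ne2PlusSite_torus_pow_two` (for the rate-less `X_N k ≡ 2^k`,
  `L = 2`, both types are FALSE).
* §5 INHABITANT (a), BY NAME: the (1.66)-layer torus entry kernels `ksum166Family L μ ν a b : N ↦ k ↦ Re K^{(L^k)}_{ab,N}`
  (`μ ≠ ν`), from `T4GaugeActionRateStrip.ksum_rate_king`: `ksum166_step_bound` (amplitude `C166T d·(L^k)⁻¹`, decay rate
  `delta166T d = κ₁₆₆(d+1)/(4(d+1))/(d+1)`, every `N`, `k`, `x`), `etaRateIneqSite_ksum166`, `ne2PlusSite_ksum166`,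
  `ne2ZeroSite_ksum166` (every `L ≥ 1`; `γ = 1`).
* §6 (v1.1) INHABITANT (a′), BY NAME, AT KING'S FULL EXPONENT `γ = 2`, from `T4Rate166StripDirect.ksum_rate2_king`:
  `ksum166_step_bound_king` (amplitude `C166T2 d·(L^k)^{−2}`, `C166T2 d = 8·C166(d+1)·periodConst(κ₁₆₆(d+1), d)`, decay rate
  `delta166T2 d = κ₁₆₆(d+1)/(d+1)`), `etaRateIneqSite_ksum166_king`, `ne2PlusSite_ksum166_king`, `ne2ZeroSite_ksum166_king`
  (every `L ≥ 1`; `γ = 2`).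

## v1.2 (unit `b2b-balaban-pv25-g16`) — XREAD C-pv05g13-12, VACUITY-OF-TYPE (V1), answered by the referee's repair R1

THE OBJECTION (reader pv05 gen 13, on v1.1; kernel-checked probes V1–V4 in the reader's appendix): every instance of
`torusInstance d hL` (and of `T4EtaRateSiteOfRatePair.windowInstance`) had `gf.M = 1` (`torusSiteGeo … M := 1`), while
`T4EtaRate.NE2PlusSite` and `NE2ZeroSite` guard each index by `M₅ ≤ (pi i).gf.M` with `M₅` EXISTENTIAL; hence `M₅ := 2` voided
the guard at every index and the anonymous witness
`⟨2, 1, 1, 1, 1, two_pos, one_pos, one_pos, one_pos, one_pos, fun i hM => by norm_num [torusInstance] at hM⟩` inhabited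
`NE2PlusSite d′ p c35 (torusInstance d hL) Kd` for EVERY kernel family `Kd` — the §4–§6 inhabitation theorems were true, but
their TYPE carried no content (the content-carrying statements were the guard-free, constant-explicit `EtaRateIneqSite` ones,
`etaRateIneqSite_ksum166(_king)`, `ksum166_step_bound(_king)`).  THE REPAIR (R1, this revision; same as in
`T4EtaRateSiteOfRatePair` v1.2): the carrier takes [B9]'s cube-size parameter as an argument, `torusSiteGeo d L M k N`
(`M := M`); the index `TorusIndex` gains the fields `M : ℝ`, `one_le : 1 ≤ M`; `torusInstance` / `torusStepKernels` range over
ALL `M ≥ 1`, so the guard `M₅ ≤ M` reads: for every index with `M ≥ M₅` — the threshold quantifier (for M ≥ M₁) of [B9]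
Thm 3.1's printed frame (p. 397), under whose assumptions Thm 3.2 / Thm 3.14 are stated, read literally as the tree types it
(binder template `∃ M₅ …, ∀ i, M₅ ≤ (geo i).M → …` of `B9.Thm314Printed`; attribution corrected in v1.2.1, see below), a
non-empty co-final condition.  Every §1–§3, §5, §6 declaration keeps its name, statement
shape and proof and gains the inert binder `(M : ℝ)` (explicit right after `hL` / `L`; implicit `{M}` in the two §3 producers
`etaRateIneqSite_torus_of_bound(_rpow)`); the §4–§6 family theorems keep their statements verbatim (the family is larger);
`ne2ZeroSite_torus_of_bound_rpow` moved from §6 to §4.  NEW, kernel-checked (§4): `exists_bound_of_ne2ZeroSite_torus`,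
`ne2ZeroSite_torus_iff_bound`, `ne2PlusSite_torus_iff_bound`, `not_ne2ZeroSite_torus_pow_two`, `not_ne2PlusSite_torus_pow_two`.
V1/V2 NO LONGER ELABORATE against v1.2: `norm_num [torusInstance] at hM` leaves `hM : 2 ≤ i.M` and the goal open (must-fail
probe archived by the cell next to the proposal, not in the tree); the reader's P7 (the author's own witnesses meet the guard)
survives in the form "the index `⟨k, N, max M₅ 1, _⟩` meets `M₅ ≤ M`".

## v1.2.1 (unit `b2b-balaban-pv25-g17`) — DOCSTRING-ONLY: XREAD C-pv12g18-1, DOCFIX D1 (attribution of the threshold quantifier)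

The v1.2 paragraph above (as landed in p190074) set a phrase of the form *there is M₅ such that for M ≥ M₅* in quotation
italics under the name of [B9] Thm 3.14.  That was a misattribution, corrected here and in the `M` field docstring of
`TorusIndex`: print Thm 3.14 (pp. 426–427) carries no such words and no `M₅` — it states that the difference operators
satisfy the inequalities characteristic for operators of the considered type with the additional factor
exp(−δ₀d(y, y′, Ω)) (tree `B9.Thm314Printed`, verbatim frame in its docstring).  The threshold quantifier — positive
constants M₁, δ₀, a₀, B₀ depending on d and L only, then for M ≥ M₁ — is the printed frame of [B9] Thm 3.1 (p. 397; tree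
`B9.Thm31Printed`, verbatim frame in its docstring), under whose assumptions Thm 3.2 and Thm 3.14 are stated; the tree types
it for Thm 3.14 as the binder template `∃ M₅ δ₀ a₀ B₀, … ∀ i, M₅ ≤ (geo i).M → …` of `B9.Thm314Printed`, and THAT template
is what the guard `M₅ ≤ (pi i).gf.M` of `T4EtaRate.NE2PlusSite` / `NE2ZeroSite` copies.  No statement, proof, name or
import changed (docstring text only); nothing printed is quoted anew.

## HONEST SCOPE / what is NOT claimed

(i) `U ≡ 1`, single scale (no large-field regions: the multi-scale 𝔅 with `j < k` is not instantiated), linear layer, the unit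
torus of an arbitrary period vector `N` (all `N_μ ≥ 1`); the identification of `N` with a physical volume, and of the (1.66) torus
kernels with matrix entries of Bałaban's operators, is the one stated in `B5Kernel166Decay` and is not re-derived.  (ii) As in
`T4EtaRateUnitWitness` (ii) / `T4EtaRateSiteOfRatePair` (ii): in §4–§6 the background quantifier of `NE2PlusSite` ranges over
`{U ≡ 1}` and (3.35) is trivial there — NE2⁰ CONTENT inside NE2⁺'s TYPE; the background-dependent estimate NE2⁺ (`T4EtaRate`
§3, NOT PRINTED) is neither printed nor claimed.  Rates (`γ = 1` in §5 from `ksum_rate_king`; King's full `γ = 2` in §6 from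
`ksum_rate2_king`), decay and the uniformity in `(k, N)` are genuine and come from the cited prover modules; by the v1.2
equivalences the packaged types on the torus family say EXACTLY "a `(k, N)`-uniform torus step bound with positive constants"
— no more, no less.  (iii) Nothing
printed is used as a hypothesis; the [cite] tags locate SHAPES: [B9] (3.41) p. 397 (site scale convention) and Thm 3.2 (3.48)
p. 398 (normalisation), re-used from the cross-read tree header `B9.lean`; [King1986] p. 664 (identity pairing of unit-lattice
sites across runs) and Lemma 4.5 (4.38) p. 674 (the printed `A = 0` SIBLING of the shape); [Balaban1984PropagatorsI] (1.29)
p. 23 (the torus), p. 17 l. 30 / p. 36 l. 20–23 (torus metric, dictionary of `B4TorusKernel`), (1.66) p. 29 (the object of §5,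
through the cited modules).  A DIFFERENT torus reading of [B9]'s carrier exists in the tree and is NOT imported or duplicated:
`B9Thm37GlueTorus.torusGeom` (seat pv21; ONE scale `j = 0`, `len = η`, ℓ¹ torus distance on `B5TorusCover.UT N` — the
fine-torus model for the Thm 3.7 glue, where no η-rate is read; here `scale ≡ k`, `len = 1` and King's rate factor is live).
NOT NE2⁺, NOT NE1′, NOT continuum, NOT infinite-volume Yang–Mills, NOT a mass gap, NOT Clay; rung (B)+1 finite-`T⁴` scoping;
NOT summit progress.  (iv) (v1.2) The cube-size index `M` is INERT: it enters no kernel, norm or constant of this module — only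
the guard of the packaged shapes; [B9]'s `M`-dependence ((3.35) `Mα₀ ≤ a₀`, `M ≥ M₅`) is represented as a QUANTIFIER,
faithfully, but carries no analytic content at `U ≡ 1`.

HONEST FRAMING (cell framing — a PARAPHRASE of `HOME/t4/T4-DAG.md` PAGE 1, not a quotation of it; wording inherited from the
headers of this lineage's earlier leaves): T4 is OPEN. The deliverables are: located quotations, a uniformity census, typed
hypothesis shapes, estimate sketches with every non-printed step flagged, and kernel-checked bookkeeping lemmas. None of this
is summit progress.

ABSOLUTE RULE (cell, verbatim): No internally-minted statement may enter as a cited fact. Every hypothesis is either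
kernel-proved in this package or a verbatim quotation of a PUBLISHED theorem with page reference. The manuscript(s) under
audit are NOT citable for their own disputed steps — they are the thing under adjudication; programme-internal
(2001/route/tribunal) claims are never citable.

Imports BY NAME, nothing modified: `T4EtaRateSiteOfRatePair` (own lineage: `NE2ZeroSite`, `ne2ZeroSite_of_ne2PlusSite`,
`etaRateIneqSite_mono_const`, `rpow_neg_pow_comm`; through it `T4EtaRate`, `T4EtaRateDefectSite.pt9Bg`, and seat t4-ne2-p2's
`T4GaugeActionRateStrip` §5 Torus: `ksum_rate_king`, `CWs` and `T4Rate166StripDirect` §Torus: `ksum_rate2_king`, `C166`;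
the lineage's `inv_sq_eq_rpow_neg_two`), and the torus infrastructure of seats b04 / b05 / b06 reached through the same import: `B4TorusKernel.MultiPeriod` (`torusSupNorm`, `translate`, `torusSupNorm_translate`,
`torusSupNorm_nonneg`, `torusKernel`, `torusKernel_translate`), `B4TorusKernel.periodConst`, `B5Kernel166Decay.ksum`,
`B5Prop11Plancherel.Tor`, `B6LowerBound2153Torus` (`toT`, `rep`, `toT_rep`, `isPeriod_rep_toT_sub`), `B6Lemma24Torus.IsPeriod`,
`B6Cov2156Torus.one_le_M`, `B5Symbol166Strip.kappa166(_pos)`.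
-/

namespace Literature.MathematicalPhysics.QuantumFieldTheory.Balaban1983to89.T4EtaRateSiteTorus

open Complex
open T4EtaRate (rateFactor rateFactor_unit eta_rpow_eq_theta_pow rateFactor_nonneg EtaRateIneqSite NE2PlusSite
  PairedInstance EtaPairing)
open T4EtaRateDefectSite (pt9Bg len_nonneg)
open T4EtaRateSiteOfRatePair (NE2ZeroSite ne2ZeroSite_of_ne2PlusSite etaRateIneqSite_mono_const rpow_neg_pow_comm)
open B5Prop11Plancherel (Tor)
open B6LowerBound2153Torus (toT rep toT_rep isPeriod_rep_toT_sub)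
open B6Lemma24Torus (IsPeriod)
open B6Cov2156Torus (one_le_M)
open B4TorusKernel (descendC periodConst)
open B4TorusKernel.MultiPeriod (torusSupNorm translate translate_apply torusSupNorm_translate torusSupNorm_nonneg
  torusKernel torusKernel_translate)
open B5Kernel166Decay (ksum)
open T4GaugeActionRateStrip (CWs CWs_nonneg ksum_rate_king)
open B5Symbol166Strip (kappa166 kappa166_pos)

noncomputable section

variable {d : ℕ}

/-! ## §1 The single-scale `U ≡ 1` instance of [B9]'s site carrier on the unit torus `Π_μ ℤ/N_μ` -/

/-- THE TORUS SITE CARRIER: [B9]'s 𝔅 with no large-field regions (`𝔅 = Λ_k`, every site of scale index `k`, `L^kη = 1`,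
`η = L^{−k}`) in finite volume: sites = the points of the unit torus `Tor N = Π_μ ℤ/N_μ`, `dist y y′ = |y − y′|_{T,∞}` (the
torus sup-distance of a representative), inert one-point argument / cut-off sorts with zero sizes, [B9]'s cube-size parameter
`M` as an ARGUMENT (v1.2 — the constant `1` in v1/v1.1; inert here: it enters only the guard `M₅ ≤ M` of the packaged shapes);
`reducible` so that the `Fintype` / `DecidableEq` instances of `Tor N` are found on its `Site`.
[cite: Balaban1985BackgroundPropagators, (3.41) p.397 (site scale convention); Balaban1984PropagatorsI, (1.29) p.23 (the torus) and p.17 l.30 with p.36 l.20–23 (torus metric, dictionary)] -/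
@[reducible] def torusSiteGeo (d : ℕ) (L M : ℝ) (k : ℕ) (N : Fin (d + 1) → ℕ) [∀ μ, NeZero (N μ)] : B9.Geometry where
  Site := Tor N
  scale := fun _ => k
  dist := fun y y' => torusSupNorm N (rep N (y - y'))
  k := k
  eta := (L ^ k)⁻¹
  L := L
  M := M
  Loc := Unit
  suppIn := fun _ _ => True
  suppInT := fun _ _ => True
  supNorm := fun _ => 0
  l2Norm := fun _ => 0
  wNorm := fun _ _ => 0
  holder := fun _ _ => 0
  Cut := Unit
  cutIn := fun _ _ => True
  cutInT := fun _ _ => True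
  cutH := fun _ _ => 0
  cutSup := fun _ => 0
  suppInT_of_suppIn := fun _ _ h => h
  cutInT_of_cutIn := fun _ _ h => h

section Carrier

variable (N : Fin (d + 1) → ℕ) [∀ μ, NeZero (N μ)]

/-- The distance of the torus carrier is the torus sup-distance of a representative of `y − y′`. [folklore] -/
@[simp] theorem torusSiteGeo_dist (L M : ℝ) (k : ℕ) (y y' : (torusSiteGeo d L M k N).Site) :
    (torusSiteGeo d L M k N).dist y y' = torusSupNorm N (rep N (y - y')) := rfl

/-- The distance of the torus carrier is nonnegative. [folklore] -/
theorem torusSiteGeo_dist_nonneg (L M : ℝ) (k : ℕ) (y y' : (torusSiteGeo d L M k N).Site) :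
    0 ≤ (torusSiteGeo d L M k N).dist y y' :=
  torusSupNorm_nonneg (one_le_M N) _

/-- Every site of the torus carrier has physical size `L^kη = 1` (`L ≠ 0`). [folklore] -/
@[simp] theorem torusSiteGeo_len {L : ℝ} (hL : L ≠ 0) (M : ℝ) (k : ℕ) (y : (torusSiteGeo d L M k N).Site) :
    (torusSiteGeo d L M k N).len y = 1 := by
  show L ^ k * (L ^ k)⁻¹ = 1
  exact mul_inv_cancel₀ (pow_ne_zero _ hL)

/-- The lattice spacing `η = L^{−k}` of the torus carrier is positive (`L > 0`). [folklore] -/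
theorem torusSiteGeo_eta_pos {L : ℝ} (hL : 0 < L) (M : ℝ) (k : ℕ) : 0 < (torusSiteGeo d L M k N).eta :=
  inv_pos.mpr (pow_pos hL k)

/-- KING'S RATE FACTOR IS THE CLEAN GEOMETRIC RATE at unit sites of the torus: `(η/L^jη)^γ = η^γ = (L^{−γ})^k`
(`T4EtaRate.rateFactor_unit` + `eta_rpow_eq_theta_pow`). [cite: King1986, Prop. 3.9 (3.73) p.665 and Lemma 4.5 (4.38) p.674 (rate factor, shape)] -/
theorem rateFactor_torusSiteGeo {L : ℝ} (hL : 0 < L) (M : ℝ) (k : ℕ) (γ : ℝ) (y : (torusSiteGeo d L M k N).Site) :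
    rateFactor (torusSiteGeo d L M k N) γ y = (L ^ (-γ)) ^ k := by
  rw [rateFactor_unit γ (torusSiteGeo_len N hL.ne' M k y)]
  exact eta_rpow_eq_theta_pow (g := torusSiteGeo d L M k N) rfl hL γ

end Carrier

section Kernel

variable {N : Fin (d + 1) → ℕ} [∀ μ, NeZero (N μ)]

/-- THE η-DIFFERENCE SITE KERNEL on the torus carrier over the one-point backgrounds, two-level form: for a FINE and a COARSE
translation-invariant torus function, `(U, y, y′) ↦ Xf(y − y′) − Xc(y − y′)` (identity pairing of unit-torus sites across
runs; for a scale-indexed family take `Xf = X (k+1)`, `Xc = X k`). [cite: King1986, p.664 (identity pairing convention before Prop. 3.8) and Lemma 4.5 (4.38) p.674 (shape)] -/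
def torusStepKernel (Xf Xc : Tor N → ℝ) (L M : ℝ) (k : ℕ) : B9.SiteKernel (torusSiteGeo d L M k N) pt9Bg :=
  ⟨fun _ y y' => Xf (y - y') - Xc (y - y')⟩

/-- Unfolding of `torusStepKernel`. [folklore] -/
@[simp] theorem torusStepKernel_ker (Xf Xc : Tor N → ℝ) (L M : ℝ) (k : ℕ) (U : pt9Bg.Cfg)
    (y y' : (torusSiteGeo d L M k N).Site) :
    (torusStepKernel Xf Xc L M k).ker U y y' = Xf (y - y') - Xc (y - y') := rfl

end Kernel

/-- THE IDENTITY η-PAIRING of the runs `k` (coarse, `η = L^{−k}`) and `k + 1` (fine, `η′ = L^{−(k+1)}`) on the SAME unit torus: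
`n = 1` extra scale, `η′L = η`, sites / arguments / backgrounds transported identically. [cite: King1986, p.664 (convention before Prop. 3.8)] -/
def torusPairing {L : ℝ} (hL : L ≠ 0) (M : ℝ) (k : ℕ) (N : Fin (d + 1) → ℕ) [∀ μ, NeZero (N μ)] :
    EtaPairing (torusSiteGeo d L M k N) (torusSiteGeo d L M (k + 1) N) pt9Bg pt9Bg where
  n := 1
  k_eq := rfl
  L_eq := rfl
  M_eq := rfl
  eta_eq := by
    show (L ^ (k + 1))⁻¹ * L ^ 1 = (L ^ k)⁻¹
    rw [pow_one, pow_succ, mul_inv, mul_assoc, inv_mul_cancel₀ hL, mul_one]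
  ι := fun y => y
  scale_ι := fun _ => rfl
  dist_ι := fun _ _ => rfl
  τ := fun lam => lam
  suppIn_τ := fun _ _ h => h
  supNorm_τ := fun _ => le_rfl
  avg := fun U => U
  avg_one := rfl

/-- THE INDEX of the torus family: the coarse run's number of scales `k`, the period vector `N` of the unit torus (all
`N_μ ≠ 0`) and (v1.2) [B9]'s cube-size parameter `M ≥ 1`. [folklore] -/
structure TorusIndex (d : ℕ) where
  /-- number of scales of the coarse run (`η = L^{−k}`) -/
  k : ℕ
  /-- the period vector: `N_μ` unit-lattice sites in direction `μ` -/
  N : Fin (d + 1) → ℕ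
  /-- [B9]'s cube-size parameter `M` of (3.35) (v1.2; inert at `U ≡ 1`, carried so that the guard `M₅ ≤ M` of the packaged
  shapes reads: for every index with `M ≥ M₅` — the threshold frame (for M ≥ M₁) of [B9] Thm 3.1, p. 397, in the binder
  template by which the tree's `B9.Thm314Printed` types it; v1.2.1 attribution) -/
  M : ℝ
  /-- `M ≥ 1` -/
  one_le : 1 ≤ M
  /-- all periods are nonzero -/
  [neZero : ∀ μ, NeZero (N μ)]

/-- THE PAIRED-INSTANCE FAMILY of torus carriers (runs `k`, `k + 1` on the same unit torus; ALL cube sizes `M ≥ 1` (v1.2);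
one-point backgrounds; identity pairing); the index's own `NeZero` witnesses are used (no global instance is registered).
[folklore] -/
def torusInstance (d : ℕ) {L : ℝ} (hL : L ≠ 0) (i : TorusIndex d) : PairedInstance :=
  haveI := i.neZero
  { gc := torusSiteGeo d L i.M i.k i.N
    gf := torusSiteGeo d L i.M (i.k + 1) i.N
    Bc := pt9Bg
    Bf := pt9Bg
    pair := torusPairing hL i.M i.k i.N }

/-- A SCALE-INDEXED TRANSLATION-INVARIANT TORUS FAMILY, one for every unit torus: `X N k : Tor N → ℝ`. [folklore] -/
abbrev TorusFamily (d : ℕ) : Type := ∀ (N : Fin (d + 1) → ℕ) [∀ μ, NeZero (N μ)], ℕ → Tor N → ℝ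

/-- The torus family's η-difference kernels over the index `(k, N, M)`. [folklore] -/
def torusStepKernels (X : TorusFamily d) {L : ℝ} (hL : L ≠ 0) :
    ∀ i : TorusIndex d, B9.SiteKernel (torusInstance d hL i).gc (torusInstance d hL i).Bf :=
  fun i =>
    haveI := i.neZero
    torusStepKernel (X i.N (i.k + 1)) (X i.N i.k) L i.M i.k

/-! ## §2 Representatives: the torus sup-distance and the torus kernels do not depend on the representative -/

section Representatives

variable {N : Fin (d + 1) → ℕ}

/-- Two lattice points differing by a period differ by a `translate`. [folklore] -/
theorem exists_eq_translate_of_isPeriod_sub {x x' : Fin (d + 1) → ℤ} (h : IsPeriod N (x' - x)) :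
    ∃ m : Fin (d + 1) → ℤ, x' = translate N x m := by
  have h' : ∀ i, ∃ c : ℤ, x' i = x i + (N i : ℤ) * c := fun i => by
    obtain ⟨c, hc⟩ := h i
    refine ⟨c, ?_⟩
    have : x' i - x i = (N i : ℤ) * c := by simpa [Pi.sub_apply] using hc
    linarith
  choose m hm using h'
  exact ⟨m, funext fun i => by rw [translate_apply]; exact hm i⟩

/-- The torus sup-distance depends only on the residue class. [folklore] -/
theorem torusSupNorm_eq_of_isPeriod_sub {x x' : Fin (d + 1) → ℤ} (h : IsPeriod N (x' - x)) :
    torusSupNorm N x' = torusSupNorm N x := by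
  obtain ⟨m, rfl⟩ := exists_eq_translate_of_isPeriod_sub h
  exact torusSupNorm_translate N x m

/-- `|rep(x̄)|_{T,∞} = |x|_{T,∞}`: the box representative of the class of `x` has the torus sup-distance of `x`. [folklore] -/
theorem torusSupNorm_rep_toT [∀ μ, NeZero (N μ)] (x : Fin (d + 1) → ℤ) :
    torusSupNorm N (rep N (toT N x)) = torusSupNorm N x :=
  torusSupNorm_eq_of_isPeriod_sub (isPeriod_rep_toT_sub N x)

/-- The `MultiPeriod.torusKernel` depends only on the residue class (all `N_μ ≥ 1`). [folklore] -/
theorem torusKernel_eq_of_isPeriod_sub (f : C(UnitAddTorus (Fin (d + 1)), ℂ)) (hN : ∀ i, 1 ≤ N i)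
    {x x' : Fin (d + 1) → ℤ} (h : IsPeriod N (x' - x)) : torusKernel f N x' = torusKernel f N x := by
  obtain ⟨m, rfl⟩ := exists_eq_translate_of_isPeriod_sub h
  exact torusKernel_translate f hN x m

/-- `K_N(rep(x̄)) = K_N(x)`. [folklore] -/
theorem torusKernel_rep_toT [∀ μ, NeZero (N μ)] (f : C(UnitAddTorus (Fin (d + 1)), ℂ)) (x : Fin (d + 1) → ℤ) :
    torusKernel f N (rep N (toT N x)) = torusKernel f N x :=
  torusKernel_eq_of_isPeriod_sub f (one_le_M N) (isPeriod_rep_toT_sub N x)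

end Representatives

/-! ## §3 The dictionary: `EtaRateIneqSite` on the torus carrier, at torus points and at lattice representatives -/

section Dictionary

variable {N : Fin (d + 1) → ℕ} [∀ μ, NeZero (N μ)]

/-- `(L^{−1})^k = (L^k)⁻¹` (`L ≥ 0`): the clean rate with `γ = 1`. [folklore] -/
theorem rpow_neg_one_pow {L : ℝ} (hL : 0 ≤ L) (k : ℕ) : (L ^ (-(1 : ℝ))) ^ k = (L ^ k)⁻¹ := by
  rw [rpow_neg_pow_comm hL 1 k, Real.rpow_neg_one]

/-- **THE DICTIONARY, torus points.**  On the torus carrier the (3.48) weights are `1` and the max-rate-factor is `(L^{−γ})^k`: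
`EtaRateIneqSite d′ p (torusStepKernel Xf Xc L M k) C δ γ U` IS
`∀ y y′ ∈ Tor N, |Xf(y−y′) − Xc(y−y′)| ≤ C·e^{−δ|y−y′|_{T,∞}}·(L^{−γ})^k`.
[cite: Balaban1985BackgroundPropagators, Thm 3.2 (3.48) p.398 (normalisation, shape); King1986, Lemma 4.5 (4.38) p.674 (A = 0 sibling)] -/
theorem etaRateIneqSite_torus_iff {L : ℝ} (hL : 0 < L) (M : ℝ) (k : ℕ) (Xf Xc : Tor N → ℝ) (d' : ℕ) (p C δ γ : ℝ)
    (U : pt9Bg.Cfg) :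
    EtaRateIneqSite d' p (torusStepKernel Xf Xc L M k) C δ γ U ↔
      ∀ y y' : Tor N, |Xf (y - y') - Xc (y - y')| ≤
        C * Real.exp (-(δ * torusSupNorm N (rep N (y - y')))) * (L ^ (-γ)) ^ k := by
  have key : ∀ y y' : (torusSiteGeo d L M k N).Site,
      C * (torusSiteGeo d L M k N).len y ^ (-p) * (torusSiteGeo d L M k N).len y' ^ (-(d' : ℝ)) *
          Real.exp (-(δ * (torusSiteGeo d L M k N).dist y y')) *
          max (rateFactor (torusSiteGeo d L M k N) γ y) (rateFactor (torusSiteGeo d L M k N) γ y') =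
        C * Real.exp (-(δ * torusSupNorm N (rep N (y - y')))) * (L ^ (-γ)) ^ k := by
    intro y y'
    rw [torusSiteGeo_len N hL.ne', torusSiteGeo_len N hL.ne', rateFactor_torusSiteGeo N hL M k γ y,
      rateFactor_torusSiteGeo N hL M k γ y', Real.one_rpow, Real.one_rpow, max_self, torusSiteGeo_dist]
    ring
  constructor
  · intro h y y'
    have H := h y y'
    rw [key, torusStepKernel_ker] at H
    exact H
  · intro h y y'
    rw [key, torusStepKernel_ker]
    exact h y y'

/-- **THE DICTIONARY, one torus point** (translation invariance): the site inequality IS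
`∀ t ∈ Tor N, |Xf(t) − Xc(t)| ≤ C·e^{−δ|t|_{T,∞}}·(L^{−γ})^k`. [folklore] -/
theorem etaRateIneqSite_torus_iff' {L : ℝ} (hL : 0 < L) (M : ℝ) (k : ℕ) (Xf Xc : Tor N → ℝ) (d' : ℕ) (p C δ γ : ℝ)
    (U : pt9Bg.Cfg) :
    EtaRateIneqSite d' p (torusStepKernel Xf Xc L M k) C δ γ U ↔
      ∀ t : Tor N, |Xf t - Xc t| ≤ C * Real.exp (-(δ * torusSupNorm N (rep N t))) * (L ^ (-γ)) ^ k := by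
  rw [etaRateIneqSite_torus_iff hL]
  constructor
  · intro h t
    simpa using h t 0
  · intro h y y'
    exact h (y - y')

/-- **THE DICTIONARY AT LATTICE REPRESENTATIVES** — the format of the tree's torus rate theorems: the site inequality IS
`∀ x ∈ ℤ^{d+1}, |Xf(x̄) − Xc(x̄)| ≤ C·e^{−δ·torusSupNorm N x}·(L^{−γ})^k` (`x̄ = toT N x`; `torusSupNorm_rep_toT`, `toT_rep`).
[folklore] -/
theorem etaRateIneqSite_torus_iff_lattice {L : ℝ} (hL : 0 < L) (M : ℝ) (k : ℕ) (Xf Xc : Tor N → ℝ) (d' : ℕ) (p C δ γ : ℝ)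
    (U : pt9Bg.Cfg) :
    EtaRateIneqSite d' p (torusStepKernel Xf Xc L M k) C δ γ U ↔
      ∀ x : Fin (d + 1) → ℤ, |Xf (toT N x) - Xc (toT N x)| ≤
        C * Real.exp (-(δ * torusSupNorm N x)) * (L ^ (-γ)) ^ k := by
  rw [etaRateIneqSite_torus_iff' hL]
  constructor
  · intro h x
    have H := h (toT N x)
    rwa [torusSupNorm_rep_toT] at H
  · intro h t
    have H := h (rep N t)
    rwa [toT_rep] at H

/-- **TORUS STEP BOUNDS PRODUCE THE SITE LAYER** (general rate exponent): a bound at lattice representatives with amplitude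
`A·(L^k)^{−γ}` and decay rate `δ` in the torus sup-distance gives `EtaRateIneqSite d′ p (torusStepKernel Xf Xc L M k) A δ γ U`
for EVERY exponent pair `(d′, p)`. [folklore] -/
theorem etaRateIneqSite_torus_of_bound_rpow {L : ℝ} (hL : 0 < L) {M : ℝ} {k : ℕ} {Xf Xc : Tor N → ℝ} {A δ γ : ℝ}
    (h : ∀ x : Fin (d + 1) → ℤ, |Xf (toT N x) - Xc (toT N x)| ≤
      A * (L ^ k) ^ (-γ) * Real.exp (-(δ * torusSupNorm N x)))
    (d' : ℕ) (p : ℝ) (U : pt9Bg.Cfg) : EtaRateIneqSite d' p (torusStepKernel Xf Xc L M k) A δ γ U := by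
  rw [etaRateIneqSite_torus_iff_lattice hL]
  intro x
  rw [rpow_neg_pow_comm hL.le γ k]
  calc |Xf (toT N x) - Xc (toT N x)| ≤ A * (L ^ k) ^ (-γ) * Real.exp (-(δ * torusSupNorm N x)) := h x
    _ = A * Real.exp (-(δ * torusSupNorm N x)) * (L ^ k) ^ (-γ) := by ring

/-- **TORUS STEP BOUNDS PRODUCE THE SITE LAYER**, first order in `η` (`γ = 1`): amplitude `A·(L^k)⁻¹`. [folklore] -/
theorem etaRateIneqSite_torus_of_bound {L : ℝ} (hL : 0 < L) {M : ℝ} {k : ℕ} {Xf Xc : Tor N → ℝ} {A δ : ℝ}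
    (h : ∀ x : Fin (d + 1) → ℤ, |Xf (toT N x) - Xc (toT N x)| ≤ A * (L ^ k)⁻¹ * Real.exp (-(δ * torusSupNorm N x)))
    (d' : ℕ) (p : ℝ) (U : pt9Bg.Cfg) : EtaRateIneqSite d' p (torusStepKernel Xf Xc L M k) A δ 1 U :=
  etaRateIneqSite_torus_of_bound_rpow hL (fun x => by rw [Real.rpow_neg_one]; exact h x) d' p U

end Dictionary

/-! ## §4 Packaging over the `(k, N, M)`-family: `NE2PlusSite` and `NE2ZeroSite`, the uniformity in the volume inside the `∃`;
the READOUT (v1.2): the packaged types ⟺ a `(k, N)`-uniform torus step bound -/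

section Family

variable {X : TorusFamily d} {L : ℝ}

/-- **`NE2PlusSite` IS INHABITED by the torus family of any scale-indexed torus family with a step bound whose constants
`(A, δ, γ)` do not depend on `(k, N)`** (`δ, γ > 0`, `L > 0`), for every exponent pair `(d′, p)` and geometric constant `c35`:
constants `(M₅, δ, a₀, C, γ) = (1, δ, 1, max A 1, γ)`.  HONEST SCOPE (ii): the background quantifier ranges over `{U ≡ 1}` and
(3.35) is trivial there — NE2⁰ CONTENT inside NE2⁺'s TYPE, not the background-dependent estimate NE2⁺ (NOT PRINTED, not
claimed); rate, decay and uniformity in `(k, N, M)` are genuine.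
[cite: Balaban1985BackgroundPropagators, Thm 3.2 (3.48) p.398 + Thm 3.14 pp.426–427 (quantifier template)] [folklore] -/
theorem ne2PlusSite_torus_of_bound_rpow (hL : 0 < L) {A δ γ : ℝ} (hδ : 0 < δ) (hγ : 0 < γ)
    (h : ∀ (N : Fin (d + 1) → ℕ) [∀ μ, NeZero (N μ)] (k : ℕ) (x : Fin (d + 1) → ℤ),
      |X N (k + 1) (toT N x) - X N k (toT N x)| ≤ A * (L ^ k) ^ (-γ) * Real.exp (-(δ * torusSupNorm N x)))
    (d' : ℕ) (p c35 : ℝ) :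
    NE2PlusSite d' p c35 (torusInstance d hL.ne') (torusStepKernels X hL.ne') := by
  refine ⟨1, δ, 1, max A 1, γ, one_pos, hδ, one_pos, lt_max_of_lt_right one_pos, hγ,
    fun i _ α₀ _ _ U _ => ?_⟩
  haveI := i.neZero
  exact etaRateIneqSite_mono_const (g := torusSiteGeo d L i.M i.k i.N) hL.le (torusSiteGeo_eta_pos i.N hL i.M i.k).le
    (le_max_left A 1) (etaRateIneqSite_torus_of_bound_rpow hL (h i.N i.k) d' p U)

/-- The same, first order in `η` (`γ = 1`, amplitude `A·(L^k)⁻¹`). [folklore] -/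
theorem ne2PlusSite_torus_of_bound (hL : 0 < L) {A δ : ℝ} (hδ : 0 < δ)
    (h : ∀ (N : Fin (d + 1) → ℕ) [∀ μ, NeZero (N μ)] (k : ℕ) (x : Fin (d + 1) → ℤ),
      |X N (k + 1) (toT N x) - X N k (toT N x)| ≤ A * (L ^ k)⁻¹ * Real.exp (-(δ * torusSupNorm N x)))
    (d' : ℕ) (p c35 : ℝ) :
    NE2PlusSite d' p c35 (torusInstance d hL.ne') (torusStepKernels X hL.ne') :=
  ne2PlusSite_torus_of_bound_rpow hL hδ one_pos (fun N _ k x => by rw [Real.rpow_neg_one]; exact h N k x) d' p c35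

/-- **`NE2ZeroSite` HOLDS for the torus family of any such torus family** (`γ = 1`) — hypothesis-free in the background (there
is none but `U ≡ 1`). [folklore] -/
theorem ne2ZeroSite_torus_of_bound (hL : 0 < L) {A δ : ℝ} (hδ : 0 < δ)
    (h : ∀ (N : Fin (d + 1) → ℕ) [∀ μ, NeZero (N μ)] (k : ℕ) (x : Fin (d + 1) → ℤ),
      |X N (k + 1) (toT N x) - X N k (toT N x)| ≤ A * (L ^ k)⁻¹ * Real.exp (-(δ * torusSupNorm N x)))
    (d' : ℕ) (p : ℝ) :
    NE2ZeroSite d' p (torusInstance d hL.ne') (torusStepKernels X hL.ne') :=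
  ne2ZeroSite_of_ne2PlusSite (c35 := 0) (fun _ _ _ => trivial) (ne2PlusSite_torus_of_bound hL hδ h d' p 0)

/-- **`NE2ZeroSite` HOLDS for the torus family of any torus family with a `(k, N)`-uniform step bound at a general rate
exponent `γ > 0`** (companion of `ne2ZeroSite_torus_of_bound`; v1.1, moved to §4 in v1.2). [folklore] -/
theorem ne2ZeroSite_torus_of_bound_rpow (hL : 0 < L) {A δ γ : ℝ} (hδ : 0 < δ) (hγ : 0 < γ)
    (h : ∀ (N : Fin (d + 1) → ℕ) [∀ μ, NeZero (N μ)] (k : ℕ) (x : Fin (d + 1) → ℤ),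
      |X N (k + 1) (toT N x) - X N k (toT N x)| ≤ A * (L ^ k) ^ (-γ) * Real.exp (-(δ * torusSupNorm N x)))
    (d' : ℕ) (p : ℝ) :
    NE2ZeroSite d' p (torusInstance d hL.ne') (torusStepKernels X hL.ne') :=
  ne2ZeroSite_of_ne2PlusSite (c35 := 0) (fun _ _ _ => trivial) (ne2PlusSite_torus_of_bound_rpow hL hδ hγ h d' p 0)

/-- **READOUT — THE PACKAGED TYPE IS NOT VACUOUS (v1.2, answering XREAD C-pv05g13-12, V1/V2).**  On the torus family (indexed
by `(k, N, M)`, ALL `M ≥ 1`) a proof of `NE2ZeroSite d′ p` RETURNS a torus step bound at lattice representatives — amplitude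
`C·(L^k)^{−γ}`, decay rate `δ` in the torus sup-distance, `C, δ, γ > 0`, UNIFORM IN `(k, N)`: the index `M := max M₅ 1`
discharges the guard `M₅ ≤ M` and `etaRateIneqSite_torus_iff_lattice` reads the bound off.  (Under v1.1's `M := 1` carriers,
`M₅ := 2` voided the guard at every index and the type was inhabited for EVERY kernel family.) [folklore] -/
theorem exists_bound_of_ne2ZeroSite_torus (hL : 0 < L) {d' : ℕ} {p : ℝ}
    (h : NE2ZeroSite d' p (torusInstance d hL.ne') (torusStepKernels X hL.ne')) :
    ∃ C δ γ : ℝ, 0 < C ∧ 0 < δ ∧ 0 < γ ∧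
      ∀ (N : Fin (d + 1) → ℕ) [∀ μ, NeZero (N μ)] (k : ℕ) (x : Fin (d + 1) → ℤ),
        |X N (k + 1) (toT N x) - X N k (toT N x)| ≤ C * (L ^ k) ^ (-γ) * Real.exp (-(δ * torusSupNorm N x)) := by
  obtain ⟨M₅, δ, C, γ, _, hδ, hC, hγ, H⟩ := h
  refine ⟨C, δ, γ, hC, hδ, hγ, fun N _ k x => ?_⟩
  have h1 := (etaRateIneqSite_torus_iff_lattice hL (max M₅ 1) k (X N (k + 1)) (X N k) d' p C δ γ ()).mp
    (H ⟨k, N, max M₅ 1, le_max_right M₅ 1⟩ (le_max_left M₅ 1)) x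
  rw [rpow_neg_pow_comm hL.le γ k] at h1
  calc |X N (k + 1) (toT N x) - X N k (toT N x)| ≤ C * Real.exp (-(δ * torusSupNorm N x)) * (L ^ k) ^ (-γ) := h1
    _ = C * (L ^ k) ^ (-γ) * Real.exp (-(δ * torusSupNorm N x)) := by ring

/-- **`NE2ZeroSite` ON THE TORUS FAMILY ⟺ A `(k, N)`-UNIFORM TORUS STEP BOUND WITH POSITIVE CONSTANTS** (amplitude
`A·(L^k)^{−γ}`, `L > 0`): the packaged site-layer type on the `U ≡ 1` torus family of a torus family `X` IS the format of the
tree's torus rate theorems — neither vacuous nor more (v1.2). [folklore] -/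
theorem ne2ZeroSite_torus_iff_bound (hL : 0 < L) (d' : ℕ) (p : ℝ) :
    NE2ZeroSite d' p (torusInstance d hL.ne') (torusStepKernels X hL.ne') ↔
      ∃ A δ γ : ℝ, 0 < A ∧ 0 < δ ∧ 0 < γ ∧
        ∀ (N : Fin (d + 1) → ℕ) [∀ μ, NeZero (N μ)] (k : ℕ) (x : Fin (d + 1) → ℤ),
          |X N (k + 1) (toT N x) - X N k (toT N x)| ≤ A * (L ^ k) ^ (-γ) * Real.exp (-(δ * torusSupNorm N x)) :=
  ⟨exists_bound_of_ne2ZeroSite_torus hL, fun ⟨_, _, _, _, hδ, hγ, h⟩ => ne2ZeroSite_torus_of_bound_rpow hL hδ hγ h d' p⟩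

/-- **`NE2PlusSite` ON THE TORUS FAMILY ⟺ THE SAME STEP BOUND** (every geometric constant `c35`; HONEST SCOPE (ii): at `U ≡ 1`
the (3.35) side conditions are trivially met, so NE2⁺'s TYPE on this family has exactly NE2⁰'s content) (v1.2). [folklore] -/
theorem ne2PlusSite_torus_iff_bound (hL : 0 < L) (d' : ℕ) (p c35 : ℝ) :
    NE2PlusSite d' p c35 (torusInstance d hL.ne') (torusStepKernels X hL.ne') ↔
      ∃ A δ γ : ℝ, 0 < A ∧ 0 < δ ∧ 0 < γ ∧
        ∀ (N : Fin (d + 1) → ℕ) [∀ μ, NeZero (N μ)] (k : ℕ) (x : Fin (d + 1) → ℤ),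
          |X N (k + 1) (toT N x) - X N k (toT N x)| ≤ A * (L ^ k) ^ (-γ) * Real.exp (-(δ * torusSupNorm N x)) :=
  ⟨fun h => exists_bound_of_ne2ZeroSite_torus hL (ne2ZeroSite_of_ne2PlusSite (fun _ _ _ => trivial) h),
    fun ⟨_, _, _, _, hδ, hγ, h⟩ => ne2PlusSite_torus_of_bound_rpow hL hδ hγ h d' p c35⟩

/-- **A SEPARATING FAMILY (v1.2): the packaged type is FALSE for the rate-less torus family `X_N k ≡ 2^k`** (`L = 2`, every
`d` and exponent pair) — by the readout a proof would give, at `x = 0` on the one-point torus,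
`2^k = |2^{k+1} − 2^k| ≤ C·(2^k)^{−γ}·e^{−δ·0} ≤ C` for every `k`. [folklore] -/
theorem not_ne2ZeroSite_torus_pow_two (d d' : ℕ) (p : ℝ) :
    ¬ NE2ZeroSite d' p (torusInstance d (L := (2 : ℝ)) two_ne_zero)
        (torusStepKernels (fun _ _ k _ => (2 : ℝ) ^ k) two_ne_zero) := by
  intro h
  obtain ⟨C, δ, γ, hC, hδ, hγ, hb⟩ := exists_bound_of_ne2ZeroSite_torus two_pos h
  obtain ⟨k, hk⟩ := pow_unbounded_of_one_lt C (one_lt_two : (1 : ℝ) < 2)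
  have h0 : |(2 : ℝ) ^ (k + 1) - 2 ^ k| ≤
      C * ((2 : ℝ) ^ k) ^ (-γ) * Real.exp (-(δ * torusSupNorm (fun _ : Fin (d + 1) => (1 : ℕ)) 0)) :=
    hb (fun _ => 1) k 0
  have h2 : |(2 : ℝ) ^ (k + 1) - 2 ^ k| = 2 ^ k := by
    rw [pow_succ, show (2 : ℝ) ^ k * 2 - 2 ^ k = 2 ^ k by ring]
    exact abs_of_nonneg (pow_nonneg zero_le_two k)
  have hP : ((2 : ℝ) ^ k) ^ (-γ) ≤ 1 :=
    Real.rpow_le_one_of_one_le_of_nonpos (one_le_pow₀ one_le_two) (neg_nonpos.mpr hγ.le)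
  have hE : Real.exp (-(δ * torusSupNorm (fun _ : Fin (d + 1) => (1 : ℕ)) 0)) ≤ 1 :=
    Real.exp_le_one_iff.mpr (neg_nonpos.mpr (mul_nonneg hδ.le (torusSupNorm_nonneg (fun _ => le_rfl) _)))
  have h3 : C * ((2 : ℝ) ^ k) ^ (-γ) * Real.exp (-(δ * torusSupNorm (fun _ : Fin (d + 1) => (1 : ℕ)) 0)) ≤ C :=
    calc C * ((2 : ℝ) ^ k) ^ (-γ) * Real.exp (-(δ * torusSupNorm (fun _ : Fin (d + 1) => (1 : ℕ)) 0))
        ≤ C * 1 * 1 := mul_le_mul (mul_le_mul_of_nonneg_left hP hC.le) hE (Real.exp_pos _).le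
            (mul_nonneg hC.le zero_le_one)
      _ = C := by ring
  rw [h2] at h0
  exact absurd (h0.trans h3) (not_le.mpr hk)

/-- … hence `NE2PlusSite` is FALSE for that torus family too (every `c35`). [folklore] -/
theorem not_ne2PlusSite_torus_pow_two (d d' : ℕ) (p c35 : ℝ) :
    ¬ NE2PlusSite d' p c35 (torusInstance d (L := (2 : ℝ)) two_ne_zero)
        (torusStepKernels (fun _ _ k _ => (2 : ℝ) ^ k) two_ne_zero) :=
  fun h => not_ne2ZeroSite_torus_pow_two d d' p (ne2ZeroSite_of_ne2PlusSite (fun _ _ _ => trivial) h)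

end Family

/-! ## §5 Inhabitant (a), BY NAME: the (1.66)-layer torus entry kernels of `B5Kernel166Decay` / `T4GaugeActionRateStrip` -/

section Layer166

/-- THE (1.66)-LAYER TORUS ENTRY-KERNEL FAMILY: `X_N k z = Re K^{(L^k)}_{ab,N}(z)`, the real part of the torus kernel
`B5Kernel166Decay.ksum N (L^k) μ ν a b` of the `(a, b)` entry of the matrix symbol of the `(μ, ν)` term of (1.66) at `η = L^{−k}`.
[cite: Balaban1984PropagatorsI, (1.66) p.29 (object; packaging `B5Kernel166Decay.ksum`)] [folklore] -/
def ksum166Family (L : ℕ) (μ ν a b : Fin (d + 1)) : TorusFamily d :=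
  fun N _ k z => (ksum N (L ^ k) μ ν a b z).re

/-- the decay rate of the (1.66) torus rate theorem: `κ₁₆₆(d+1)/(4(d+1))/(d+1)`. [folklore] -/
def delta166T (d : ℕ) : ℝ := kappa166 (d + 1) / (4 * ((d : ℝ) + 1)) / ((d : ℝ) + 1)

/-- the amplitude constant of the (1.66) torus rate theorem: `8·CWs(d+1)·periodConst(κ₁₆₆(d+1)/(4(d+1)), d)`. [folklore] -/
def C166T (d : ℕ) : ℝ := 8 * CWs (d + 1) * periodConst (kappa166 (d + 1) / (4 * ((d : ℝ) + 1))) d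

/-- `0 < delta166T d`. [folklore] -/
theorem delta166T_pos (d : ℕ) : 0 < delta166T d := by
  unfold delta166T
  have := kappa166_pos (d + 1)
  positivity

/-- **THE (1.66) TORUS STEP BOUND, BY NAME** (`T4GaugeActionRateStrip.ksum_rate_king` with one extra scale), every `L ≥ 1`,
`μ ≠ ν`, every period vector `N`, every `k`, every `x ∈ ℤ^{d+1}`:
`|Re K^{(L^{k+1})}_{ab,N}(x̄) − Re K^{(L^k)}_{ab,N}(x̄)| ≤ C166T d·(L^k)⁻¹·e^{−delta166T d·|x|_{T,∞}}`. [folklore] -/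
theorem ksum166_step_bound (L : ℕ) [NeZero L] {μ ν : Fin (d + 1)} (hμν : μ ≠ ν) (a b : Fin (d + 1))
    (N : Fin (d + 1) → ℕ) [∀ μ, NeZero (N μ)] (k : ℕ) (x : Fin (d + 1) → ℤ) :
    |ksum166Family L μ ν a b N (k + 1) (toT N x) - ksum166Family L μ ν a b N k (toT N x)|
      ≤ C166T d * ((L : ℝ) ^ k)⁻¹ * Real.exp (-(delta166T d * torusSupNorm N x)) := by
  have h := ksum_rate_king N L k 1 hμν a b x
  calc |ksum166Family L μ ν a b N (k + 1) (toT N x) - ksum166Family L μ ν a b N k (toT N x)|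
      = |(ksum N (L ^ (k + 1)) μ ν a b (toT N x) - ksum N (L ^ k) μ ν a b (toT N x)).re| := by
        simp only [ksum166Family, Complex.sub_re]
    _ ≤ ‖ksum N (L ^ (k + 1)) μ ν a b (toT N x) - ksum N (L ^ k) μ ν a b (toT N x)‖ := abs_re_le_norm _
    _ ≤ 8 * CWs (d + 1) * ((L : ℝ) ^ k)⁻¹ * periodConst (kappa166 (d + 1) / (4 * ((d : ℝ) + 1))) d
          * Real.exp (-(kappa166 (d + 1) / (4 * ((d : ℝ) + 1)) / (d + 1) * torusSupNorm N x)) := h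
    _ = C166T d * ((L : ℝ) ^ k)⁻¹ * Real.exp (-(delta166T d * torusSupNorm N x)) := by
        simp only [C166T, delta166T]
        ring

/-- **THE (1.66) LAYER INHABITS THE TYPED SITE LAYER ON EVERY UNIT TORUS** (every `L ≥ 1`, `μ ≠ ν`, `a`, `b`, `N`, `k`,
exponent pair, at `U ≡ 1`): `EtaRateIneqSite d′ p (torusStepKernel (X_N (k+1)) (X_N k) L k) (C166T d) (delta166T d) 1 U`.
[cite: Balaban1984PropagatorsI, (1.66) p.29 (object)] [folklore] -/
theorem etaRateIneqSite_ksum166 (L : ℕ) [NeZero L] {μ ν : Fin (d + 1)} (hμν : μ ≠ ν) (a b : Fin (d + 1))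
    (N : Fin (d + 1) → ℕ) [∀ μ, NeZero (N μ)] (M : ℝ) (k : ℕ) (d' : ℕ) (p : ℝ) (U : pt9Bg.Cfg) :
    EtaRateIneqSite d' p
      (torusStepKernel (ksum166Family L μ ν a b N (k + 1)) (ksum166Family L μ ν a b N k) (L : ℝ) M k)
      (C166T d) (delta166T d) 1 U :=
  etaRateIneqSite_torus_of_bound (by exact_mod_cast Nat.pos_of_ne_zero (NeZero.ne L))
    (ksum166_step_bound L hμν a b N k) d' p U

/-- **`NE2PlusSite` IS INHABITED BY THE (1.66) TORUS FAMILY, UNIFORMLY IN THE VOLUME** (every `L ≥ 1`, `μ ≠ ν`; `γ = 1`,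
`δ = delta166T d > 0`, `C = max (C166T d) 1`; the rate `θ = L⁻¹` is `< 1` iff `L ≥ 2` — the shape records `γ`, not `θ`), for
every exponent pair and geometric constant.  HONEST SCOPE (ii): NE2⁰ content inside NE2⁺'s type; NOT NE2⁺.
[cite: Balaban1984PropagatorsI, (1.66) p.29 (object); Balaban1985BackgroundPropagators, Thm 3.14 pp.426–427 (quantifier template)] [folklore] -/
theorem ne2PlusSite_ksum166 (L : ℕ) [NeZero L] {μ ν : Fin (d + 1)} (hμν : μ ≠ ν) (a b : Fin (d + 1))
    (d' : ℕ) (p c35 : ℝ) :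
    NE2PlusSite d' p c35
      (torusInstance d (L := (L : ℝ)) (by exact_mod_cast NeZero.ne L))
      (torusStepKernels (ksum166Family (d := d) L μ ν a b) (by exact_mod_cast NeZero.ne L)) :=
  ne2PlusSite_torus_of_bound (by exact_mod_cast Nat.pos_of_ne_zero (NeZero.ne L)) (delta166T_pos d)
    (fun N _ k x => ksum166_step_bound L hμν a b N k x) d' p c35

/-- **`NE2ZeroSite` IS A THEOREM for the (1.66) torus family** (every `L ≥ 1`, `μ ≠ ν`): the `A = 0` site-layer shape holds
on every unit torus with `γ = 1`, `δ = delta166T d`, hypothesis-free, uniformly in `(k, N)`.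
[cite: Balaban1984PropagatorsI, (1.66) p.29 (object); King1986, Lemma 4.5 (4.38) p.674 (A = 0 sibling, shape)] [folklore] -/
theorem ne2ZeroSite_ksum166 (L : ℕ) [NeZero L] {μ ν : Fin (d + 1)} (hμν : μ ≠ ν) (a b : Fin (d + 1))
    (d' : ℕ) (p : ℝ) :
    NE2ZeroSite d' p
      (torusInstance d (L := (L : ℝ)) (by exact_mod_cast NeZero.ne L))
      (torusStepKernels (ksum166Family (d := d) L μ ν a b) (by exact_mod_cast NeZero.ne L)) :=
  ne2ZeroSite_torus_of_bound (by exact_mod_cast Nat.pos_of_ne_zero (NeZero.ne L)) (delta166T_pos d)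
    (fun N _ k x => ksum166_step_bound L hμν a b N k x) d' p

end Layer166

/-! ## §6 Inhabitant (a′), BY NAME, AT KING'S FULL EXPONENT `γ = 2`: `T4Rate166StripDirect.ksum_rate2_king` (v1.1) -/

section Layer166King

open T4Rate166StripDirect (C166 C166_pos ksum_rate2_king)
open T4EtaRateSiteOfRatePair (inv_sq_eq_rpow_neg_two)

/-- the decay rate of the second-order (1.66) torus rate theorem: `κ₁₆₆(d+1)/(d+1)` (the FULL strip width). [folklore] -/
def delta166T2 (d : ℕ) : ℝ := kappa166 (d + 1) / ((d : ℝ) + 1)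

/-- the amplitude constant of the second-order (1.66) torus rate theorem: `8·C166(d+1)·periodConst(κ₁₆₆(d+1), d)`. [folklore] -/
def C166T2 (d : ℕ) : ℝ := 8 * C166 (d + 1) * periodConst (kappa166 (d + 1)) d

/-- `0 < delta166T2 d`. [folklore] -/
theorem delta166T2_pos (d : ℕ) : 0 < delta166T2 d := by
  unfold delta166T2
  have := kappa166_pos (d + 1)
  positivity

/-- **THE (1.66) TORUS STEP BOUND AT KING'S EXPONENT, BY NAME** (`T4Rate166StripDirect.ksum_rate2_king` with one extra
scale), every `L ≥ 1`, `μ ≠ ν`, every period vector `N`, every `k`, every `x ∈ ℤ^{d+1}`: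
`|Re K^{(L^{k+1})}_{ab,N}(x̄) − Re K^{(L^k)}_{ab,N}(x̄)| ≤ C166T2 d·(L^k)^{−2}·e^{−delta166T2 d·|x|_{T,∞}}` — SECOND order in `η`.
[cite: King1986, Prop. 3.9 (3.73) p.665 (the exponent γ, shape)] [folklore] -/
theorem ksum166_step_bound_king (L : ℕ) [NeZero L] {μ ν : Fin (d + 1)} (hμν : μ ≠ ν) (a b : Fin (d + 1))
    (N : Fin (d + 1) → ℕ) [∀ μ, NeZero (N μ)] (k : ℕ) (x : Fin (d + 1) → ℤ) :
    |ksum166Family L μ ν a b N (k + 1) (toT N x) - ksum166Family L μ ν a b N k (toT N x)|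
      ≤ C166T2 d * ((L : ℝ) ^ k) ^ (-(2 : ℝ)) * Real.exp (-(delta166T2 d * torusSupNorm N x)) := by
  have h := ksum_rate2_king N L k 1 hμν a b x
  rw [← inv_sq_eq_rpow_neg_two (by positivity)]
  calc |ksum166Family L μ ν a b N (k + 1) (toT N x) - ksum166Family L μ ν a b N k (toT N x)|
      = |(ksum N (L ^ (k + 1)) μ ν a b (toT N x) - ksum N (L ^ k) μ ν a b (toT N x)).re| := by
        simp only [ksum166Family, Complex.sub_re]
    _ ≤ ‖ksum N (L ^ (k + 1)) μ ν a b (toT N x) - ksum N (L ^ k) μ ν a b (toT N x)‖ := abs_re_le_norm _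
    _ ≤ 8 * C166 (d + 1) / (((L : ℝ) ^ k) ^ 2) * periodConst (kappa166 (d + 1)) d
          * Real.exp (-(kappa166 (d + 1) / (d + 1) * torusSupNorm N x)) := h
    _ = C166T2 d * (((L : ℝ) ^ k) ^ 2)⁻¹ * Real.exp (-(delta166T2 d * torusSupNorm N x)) := by
        simp only [C166T2, delta166T2, div_eq_mul_inv]
        ring

/-- **THE (1.66) LAYER INHABITS THE TYPED SITE LAYER ON EVERY UNIT TORUS AT KING'S EXPONENT `γ = 2`** (every `L ≥ 1`,
`μ ≠ ν`, `a`, `b`, `N`, `k`, exponent pair, at `U ≡ 1`):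
`EtaRateIneqSite d′ p (torusStepKernel (X_N (k+1)) (X_N k) L k) (C166T2 d) (delta166T2 d) 2 U`.
[cite: Balaban1984PropagatorsI, (1.66) p.29 (object); King1986, Prop. 3.9 (3.73) p.665 (the exponent)] [folklore] -/
theorem etaRateIneqSite_ksum166_king (L : ℕ) [NeZero L] {μ ν : Fin (d + 1)} (hμν : μ ≠ ν) (a b : Fin (d + 1))
    (N : Fin (d + 1) → ℕ) [∀ μ, NeZero (N μ)] (M : ℝ) (k : ℕ) (d' : ℕ) (p : ℝ) (U : pt9Bg.Cfg) :
    EtaRateIneqSite d' p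
      (torusStepKernel (ksum166Family L μ ν a b N (k + 1)) (ksum166Family L μ ν a b N k) (L : ℝ) M k)
      (C166T2 d) (delta166T2 d) 2 U :=
  etaRateIneqSite_torus_of_bound_rpow (by exact_mod_cast Nat.pos_of_ne_zero (NeZero.ne L))
    (ksum166_step_bound_king L hμν a b N k) d' p U

/-- **`NE2PlusSite` IS INHABITED BY THE (1.66) TORUS FAMILY AT KING'S EXPONENT `γ = 2`, UNIFORMLY IN THE VOLUME** (every
`L ≥ 1`, `μ ≠ ν`; `δ = delta166T2 d > 0`, `C = max (C166T2 d) 1`), for every exponent pair and geometric constant.  HONEST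
SCOPE (ii): NE2⁰ content inside NE2⁺'s type; NOT NE2⁺.
[cite: Balaban1984PropagatorsI, (1.66) p.29 (object); King1986, Prop. 3.9 (3.73) p.665 (the exponent); Balaban1985BackgroundPropagators, Thm 3.14 pp.426–427 (quantifier template)] [folklore] -/
theorem ne2PlusSite_ksum166_king (L : ℕ) [NeZero L] {μ ν : Fin (d + 1)} (hμν : μ ≠ ν) (a b : Fin (d + 1))
    (d' : ℕ) (p c35 : ℝ) :
    NE2PlusSite d' p c35
      (torusInstance d (L := (L : ℝ)) (by exact_mod_cast NeZero.ne L))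
      (torusStepKernels (ksum166Family (d := d) L μ ν a b) (by exact_mod_cast NeZero.ne L)) :=
  ne2PlusSite_torus_of_bound_rpow (by exact_mod_cast Nat.pos_of_ne_zero (NeZero.ne L)) (delta166T2_pos d) two_pos
    (fun N _ k x => ksum166_step_bound_king L hμν a b N k x) d' p c35

/-- **`NE2ZeroSite` IS A THEOREM for the (1.66) torus family AT KING'S EXPONENT** (every `L ≥ 1`, `μ ≠ ν`): `γ = 2`,
`δ = delta166T2 d`, hypothesis-free, uniformly in `(k, N)`.
[cite: Balaban1984PropagatorsI, (1.66) p.29 (object); King1986, Prop. 3.9 (3.73) p.665 (the exponent) and Lemma 4.5 (4.38) p.674 (A = 0 sibling, shape)] [folklore] -/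
theorem ne2ZeroSite_ksum166_king (L : ℕ) [NeZero L] {μ ν : Fin (d + 1)} (hμν : μ ≠ ν) (a b : Fin (d + 1))
    (d' : ℕ) (p : ℝ) :
    NE2ZeroSite d' p
      (torusInstance d (L := (L : ℝ)) (by exact_mod_cast NeZero.ne L))
      (torusStepKernels (ksum166Family (d := d) L μ ν a b) (by exact_mod_cast NeZero.ne L)) :=
  ne2ZeroSite_torus_of_bound_rpow (by exact_mod_cast Nat.pos_of_ne_zero (NeZero.ne L)) (delta166T2_pos d) two_pos
    (fun N _ k x => ksum166_step_bound_king L hμν a b N k x) d' p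

end Layer166King


end

end Literature.MathematicalPhysics.QuantumFieldTheory.Balaban1983to89.T4EtaRateSiteTorus
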